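import Summits.Ventures.PercRepro.Night2FatXDichotomy

/-!
# night-2: the fat case without genericity — every lossy big pair has a good point

The gen-33 closure of the fat case of (FAIR) (`localShadowHall_fat_of_generic`) assumes GENERIC off-points: no
three-point line of `V` coplanar with the two points of `G ∖ clF B₀`.  That hypothesis is used in exactly one way:
a lossy big pair without good points has its line coplanar with the off-points (`rkN_line_off_le_three_of_no_gtPts`),
so with generic off-points EVERY lossy big pair has a good point and no distance-2 load exists.  This module isolates
that consequence as the hypothesis `hgood` («every lossy big pair of `G` has a good point»):

* **`gtPts_nonempty_of_generic`** / **`good_of_generic`**: generic off-points give `hgood`;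
* **`loaded_fat_target_dist_one_of_good`**: under `hgood` a loaded target `T ⊆ G` carries a rank-`2` line
  `R ⊆ (T ∖ K) ∖ {w₀, x}` with `|R| ≥ 3`, `|R| + 4 = |T ∖ K|` and `rk (G ∖ T) ≥ 3` — the distance-1 branch of
  `loaded_fat_target_dichotomy` alone.

The counting theorems of gen 33 are re-derived from this lemma under `hgood` in the modules `Night2FatYGood*`; the
remaining gap of the fat case is then exactly the regime with a lossy big pair WITHOUT good points, where `H₀` is the
union of two planes through a line coplanar with the off-points (`two_planes_of_no_gtPts`).
Paper `proofs/NIGHT-2-g34.md` §1.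
-/

namespace PercRepro.Shadow

open PercRepro.ThmH PercRepro.PerFlat

variable {α : Type*} [DecidableEq α] {M : Matroid α} [M.Finite] {G : Finset α}

/-- **With generic off-points every lossy big pair has a good point**: otherwise its rank-`2` part `R` (`|R| ≥ 3`,
`R ⊆ G ∖ K`) is coplanar with `w₀, x` (`rkN_line_off_le_three_of_no_gtPts`). -/
theorem gtPts_nonempty_of_generic (hG : G ∈ flatsQ M (5 + 1)) (hd : (gr M \ G).card = 2)
    (hk : kColoops M G = 1) (hs : ∀ e ∈ gr M, ∀ f ∈ gr M, e ≠ f → rkN M {e, f} = 2)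
    (hl : ∀ e ∈ gr M, M.Indep {e}) {B₀ : Finset α} (hB₀ : B₀ ∈ thinMembers M 5 G) {w₀ x : α}
    (hD : G \ clF M B₀ = {w₀, x})
    (hgen : ∀ R ⊆ G \ coloops M G, rkN M R = 2 → 3 ≤ R.card → 4 ≤ rkN M (insert w₀ (insert x R)))
    {B : Finset α} (hB : B ∈ thinMembers M 5 G) (hbig : 5 ≤ (B \ coloops M G).card) {z : α}
    (hz : z ∈ G \ clF M B) (h : loss M 5 G B z ≠ 0) : (gtPts M 5 G (insert z B)).Nonempty := by
  by_contra hno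
  have hcop := rkN_line_off_le_three_of_no_gtPts hG hd hk hs hl hB₀ hD hB hbig hz h hno
  obtain ⟨hR2, hRcard⟩ := rkN_sdiff_coloops_eq_two_of_loss_ne_zero hG hd hk hs hl hB hbig hz h
  obtain ⟨R, hRdef⟩ : ∃ R : Finset α,
      R = (insert z B \ coloops M G) \ coloops M (insert z B \ coloops M G) := ⟨_, rfl⟩
  rw [← hRdef] at hR2 hRcard hcop
  have hGg : G ⊆ gr M := (mem_flatsQ.1 hG).1
  have hd' : (gr M \ G).card ≤ 5 := by omega
  have hQG : insert z B ⊆ G :=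
    Finset.insert_subset (Finset.mem_sdiff.1 hz).1 (subset_G_of_mem_thinMembers hB)
  have hKB : coloops M G ⊆ B := coloops_subset_of_mem_thinMembers hG hd' hB
  have hzB : z ∉ B := fun h' => (Finset.mem_sdiff.1 hz).2 (subset_clF_of_subset_gr
    ((subset_G_of_mem_thinMembers hB).trans hGg) h')
  have hzK : z ∉ coloops M G := fun h' => hzB (hKB h')
  have hQ'6 : 6 ≤ (insert z B \ coloops M G).card := by
    have heq : insert z B \ coloops M G = insert z (B \ coloops M G) := by
      ext e
      simp only [Finset.mem_sdiff, Finset.mem_insert]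
      constructor
      · rintro ⟨h' | h', h2⟩
        · exact Or.inl h'
        · exact Or.inr ⟨h', h2⟩
      · rintro (rfl | ⟨h', h2⟩)
        · exact ⟨Or.inl rfl, hzK⟩
        · exact ⟨Or.inr h', h2⟩
    rw [heq, Finset.card_insert_of_notMem (fun h' => hzB (Finset.mem_sdiff.1 h').1)]
    omega
  have hR3 : 3 ≤ R.card := by omega
  have hRV : R ⊆ G \ coloops M G := by
    rw [hRdef]
    exact Finset.sdiff_subset.trans (Finset.sdiff_subset_sdiff hQG (Finset.Subset.refl _))
  have := hgen R hRV hR2 hR3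
  omega

/-- **Generic off-points give `hgood`**: every lossy big pair of `G` has a good point. -/
theorem good_of_generic (hG : G ∈ flatsQ M (5 + 1)) (hd : (gr M \ G).card = 2)
    (hk : kColoops M G = 1) (hs : ∀ e ∈ gr M, ∀ f ∈ gr M, e ≠ f → rkN M {e, f} = 2)
    (hl : ∀ e ∈ gr M, M.Indep {e}) {B₀ : Finset α} (hB₀ : B₀ ∈ thinMembers M 5 G) {w₀ x : α}
    (hD : G \ clF M B₀ = {w₀, x})
    (hgen : ∀ R ⊆ G \ coloops M G, rkN M R = 2 → 3 ≤ R.card → 4 ≤ rkN M (insert w₀ (insert x R))) :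
    ∀ B ∈ thinMembers M 5 G, 5 ≤ (B \ coloops M G).card → ∀ z ∈ G \ clF M B, loss M 5 G B z ≠ 0 →
      (gtPts M 5 G (insert z B)).Nonempty :=
  fun _ hB hbig _ hz h => gtPts_nonempty_of_generic hG hd hk hs hl hB₀ hD hgen hB hbig hz h

/-- **Under `hgood` every load is a distance-1 load**: a loaded `T ⊆ G` carries a rank-`2` line
`R ⊆ (T ∖ K) ∖ {w₀, x}` with `|R| ≥ 3`, `|R| + 4 = |T ∖ K|` and `rk (G ∖ T) ≥ 3`. -/
theorem loaded_fat_target_dist_one_of_good (hG : G ∈ flatsQ M (5 + 1)) (hd : (gr M \ G).card = 2)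
    (hk : kColoops M G = 1) (hs : ∀ e ∈ gr M, ∀ f ∈ gr M, e ≠ f → rkN M {e, f} = 2)
    (hl : ∀ e ∈ gr M, M.Indep {e}) (hfat : (fatClosures M 5 G 2).card ≤ 1) {B₀ : Finset α}
    (hB₀ : B₀ ∈ thinMembers M 5 G) {w₀ x : α} (hD : G \ clF M B₀ = {w₀, x})
    (hgood : ∀ B ∈ thinMembers M 5 G, 5 ≤ (B \ coloops M G).card → ∀ z ∈ G \ clF M B,
      loss M 5 G B z ≠ 0 → (gtPts M 5 G (insert z B)).Nonempty)
    {T : Finset α} (hTG : T ⊆ G) (hload : dload M 5 G (bigP M G) (dshGT2 M 5 G) T ≠ 0) :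
    ∃ R ⊆ (T \ coloops M G) \ {w₀, x}, rkN M R = 2 ∧ 3 ≤ R.card ∧
      R.card + 4 = (T \ coloops M G).card ∧ 3 ≤ rkN M (G \ T) := by
  obtain ⟨B, hB, hbig, z, hz, hloss, hcase⟩ := exists_pair_of_dload_ne_zero' hG hd hk hs hl hfat hload
  obtain ⟨hR2, hRcard⟩ := rkN_sdiff_coloops_eq_two_of_loss_ne_zero hG hd hk hs hl hB hbig hz hloss
  obtain ⟨R, hRdef⟩ : ∃ R : Finset α,
      R = (insert z B \ coloops M G) \ coloops M (insert z B \ coloops M G) := ⟨_, rfl⟩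
  rw [← hRdef] at hR2 hRcard
  have hGg : G ⊆ gr M := (mem_flatsQ.1 hG).1
  have hd' : (gr M \ G).card ≤ 5 := by omega
  have hQG : insert z B ⊆ G :=
    Finset.insert_subset (Finset.mem_sdiff.1 hz).1 (subset_G_of_mem_thinMembers hB)
  have hKB : coloops M G ⊆ B := coloops_subset_of_mem_thinMembers hG hd' hB
  have hKQ : coloops M G ⊆ insert z B := hKB.trans (Finset.subset_insert _ _)
  have hzB : z ∉ B := fun h' => (Finset.mem_sdiff.1 hz).2 (subset_clF_of_subset_gr
    ((subset_G_of_mem_thinMembers hB).trans hGg) h')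
  have hzK : z ∉ coloops M G := fun h' => hzB (hKB h')
  have hQ'6 : 6 ≤ (insert z B \ coloops M G).card := by
    have heq : insert z B \ coloops M G = insert z (B \ coloops M G) := by
      ext e
      simp only [Finset.mem_sdiff, Finset.mem_insert]
      constructor
      · rintro ⟨h' | h', h2⟩
        · exact Or.inl h'
        · exact Or.inr ⟨h', h2⟩
      · rintro (rfl | ⟨h', h2⟩)
        · exact ⟨Or.inl rfl, hzK⟩
        · exact ⟨Or.inr h', h2⟩
    rw [heq, Finset.card_insert_of_notMem (fun h' => hzB (Finset.mem_sdiff.1 h').1)]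
    omega
  have hR3 : 3 ≤ R.card := by omega
  have hRQ' : R ⊆ insert z B \ coloops M G := by
    rw [hRdef]
    exact Finset.sdiff_subset
  have hRG : R ⊆ G := hRQ'.trans (Finset.sdiff_subset.trans hQG)
  have hoff := notMem_or_notMem_insert_of_loss_ne_zero hG hd hk hs hl hB₀ hD hB hbig hz hloss
  have hRoff : ∀ u v : α, ({w₀, x} : Finset α) = {u, v} → u ∉ insert z B → u ∉ R ∧ v ∉ R := by
    intro u v huv huQ
    have huR : u ∉ R := fun h' => huQ (Finset.mem_sdiff.1 (hRQ' h')).1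
    exact ⟨huR, notMem_of_rkN_le_two_of_notMem hs hG hD hRG (by omega) hR3
      (by rw [huv]; exact Finset.pair_comm _ _) huR⟩
  have hw₀x : w₀ ∉ R ∧ x ∉ R := by
    rcases hoff with h' | h'
    · exact hRoff w₀ x rfl h'
    · exact (hRoff x w₀ (Finset.pair_comm _ _) h').symm
  have h4 := four_le_rkN_sdiff_insert_of_loss_ne_zero hG hd hk hs hl hB hbig hz hloss
  rcases hcase with ⟨-, x', hx', rfl⟩ | ⟨hno, -⟩
  · obtain ⟨hx'G, hx'Q⟩ := Finset.mem_sdiff.1 (mem_goodPts.1 hx').1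
    have hx'K : x' ∉ coloops M G := fun h' => hx'Q (hKQ h')
    refine ⟨R, ?_, hR2, hR3, ?_, ?_⟩
    · intro r hr
      rw [Finset.mem_sdiff, Finset.mem_insert, Finset.mem_singleton]
      refine ⟨Finset.sdiff_subset_sdiff (Finset.subset_insert _ _) (Finset.Subset.refl _) (hRQ' hr), ?_⟩
      rintro (rfl | rfl)
      · exact hw₀x.1 hr
      · exact hw₀x.2 hr
    · have heq : insert x' (insert z B) \ coloops M G = insert x' (insert z B \ coloops M G) := by
        ext e
        simp only [Finset.mem_sdiff, Finset.mem_insert]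
        constructor
        · rintro ⟨h' | h', h2⟩
          · exact Or.inl h'
          · exact Or.inr ⟨h', h2⟩
        · rintro (rfl | ⟨h', h2⟩)
          · exact ⟨Or.inl rfl, hx'K⟩
          · exact ⟨Or.inr h', h2⟩
      rw [heq, Finset.card_insert_of_notMem (fun h' => hx'Q (Finset.mem_sdiff.1 h').1)]
      omega
    · have heq : G \ insert z B = insert x' (G \ insert x' (insert z B)) := by
        ext e
        simp only [Finset.mem_sdiff, Finset.mem_insert, not_or]
        constructor
        · rintro ⟨heG, heQ⟩
          by_cases hex : e = x'
          · exact Or.inl hex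
          · exact Or.inr ⟨heG, hex, heQ⟩
        · rintro (rfl | ⟨heG, -, heQ⟩)
          · refine ⟨hx'G, ?_⟩
            rwa [Finset.mem_insert, not_or] at hx'Q
          · exact ⟨heG, heQ⟩
      rw [heq] at h4
      have := rkN_insert_le_succ (M := M) (G \ insert x' (insert z B)) x'
      omega
  · exact absurd (hgood B hB hbig z hz hloss) hno

end PercRepro.Shadow
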